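/-
Copyright: statement-level skeleton of a published paper (lit-balaban cell, Phase-2 proof seat p30). No proof claims
beyond what the kernel checks below.
-/
import Literature.MathematicalPhysics.QuantumFieldTheory.BalabanImbrieJaffe1984to88.BIJ85AppAStatements

/-!
# `BalabanImbrieJaffe1984to88.BIJ85Eq611Proof` — T. Bałaban, J. Imbrie, A. Jaffe, *Renormalization of the Higgs model:
minimizers, propagators and the stability of mean field theory*, Commun. Math. Phys. **97** (1985) 299–329
[BalabanImbrieJaffe1985]: Sect. 6.1 *"σ_k = σ_{k+1} + Fluctuation Form"* — the identity **(6.1.1)** PROVED along the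
printed steps (6.1.2)–(6.1.9)

statement-level skeleton of published theorems with citation tags; proofs where landed; nothing here is a claim about the Yang–Mills mass gap

PDF held: `paper:balaban1985-cmp97-bij-higgs-minimizers` (journal page = PDF page + 298).  Renders read as images: p. 304,
305, 315, 317, 318, 319, 328 (`HOME/lit-balaban-r15/pages/1985-cmp97-bij-higgs-minimizers-p006,p007,p017,p019,p020,p021,
p030-x2.png`), p. 310, 311, 316 (`run/shared/lean/pub/pub-balaban/t4/b2b-balaban-t4-lit2/renders/bij1985/…-p012,p013,
p018-x2.png`).

CITATION HEADER (lean-in-tree rule).  Part of the lit-balaban TYPED SKELETON (HOME `run/shared/lean/pub/lit-balaban/`):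
WHAT IS REPRODUCED = rows **C1.Eq6.1.1** (the claim of Sect. 6.1) and **C1.Eq6.1.2-6.1.9** (its printed proof) of
`HOME/lit-balaban-r15/ROWS-C1.md`; Phase-2 reserve R6 of `HOME/PHASE2-TARGETS.md` §G.3 (seat p30, unit `lit-balaban-p30`).

THE PRINTED TEXT (verbatim, pp. 318–319 [PDF 20–21]).
* *"6.1. σ_k = σ_{k+1} + Fluctuation Form.  The goal here is to show that
  ⟨f^{(k)}, σ_k f^{(k)}⟩ = 𝒮_L^{−1}⟨f^{(k+1)}, σ_{k+1} f^{(k+1)}⟩ + ⟨B, Δ_kB⟩. (6.1.1)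
  In other words, the quadratic form σ_k in S_k which occurs in the integrand (6.1) can be decomposed into the sum of two
  independent forms: the (k+1)-step quadratic form scaled to the L-lattice and the quadratic form for the fluctuation
  field B."*  With (6.4) *"f^{(k)}(p) = (∂B′)(p) + L^{−d/2}(Q^{e*}f^{(k+1)})(p)"*: *"Using (6.4),
  ⟨f^{(k)},σ_kf^{(k)}⟩ = ⟨∂B′,σ_k∂B′⟩ + 2L^{−d/2}⟨∂B′,σ_kQ^{e*}f^{(k+1)}⟩ + L^{−d}⟨f^{(k+1)},Q^eσ_kQ^{e*}f^{(k+1)}⟩. (6.1.2)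
  Use definition (4.3.1) of Δ_k and the representation (4.2.2) for σ_k. In addition, note that Q^eQ^e_k = Q^e_{k+1}. Then
  ⟨f^{(k)},σ_kf^{(k)}⟩ = ⟨B′,Δ_kB′⟩ + 2L^{−d/2}⟨(I − ∂G_{k,Ax}∂^*)Q^{e*}_k∂B′, Q^{e*}_{k+1}f^{(k+1)}⟩
  + L^{−d}⟨Q^{e*}_{k+1}f^{(k+1)}, (I − ∂G_{k,Ax}∂^*)Q^{e*}_{k+1}f^{(k+1)}⟩. (6.1.3)
  By (5.3.1), H_{k,Ax} = Q^{s*}_k − G_{k,Ax}∂^*Q^{e*}_k∂. Apply ∂ to this identity, and use the gauge invariance statement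
  ∂H_{k,Ax} = ∂H_k (6.1.4) and the identity ∂Q^{s*}_k = Q^{e*}_k∂. It follows that ∂H_k = (I − ∂G_{k,Ax}∂^*)Q^{e*}_k∂. (6.1.5)
  Substituting (6.1.5) in (6.1.3) gives ⟨f^{(k)},σ_kf^{(k)}⟩ = ⟨B′,Δ_kB′⟩ + 2L^{−d/2}⟨B′,H_k^*∂^*Q^{e*}_{k+1}f^{(k+1)}⟩
  + L^{−d}⟨Q^{e*}_{k+1}f^{(k+1)}, (I − ∂G_{k,Ax}∂^*)Q^{e*}_{k+1}f^{(k+1)}⟩. (6.1.6)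
  Consider the quadratic form (6.1.6) as a function of B′ and subject to the axial gauge and averaging restrictions of
  the integral (6.1). The minimum of the form is given by Proposition A3 of the Appendix, namely
  B′ = −L^{−d/2}C^{(k)}H_k^*∂^*Q^{e*}_{k+1}f^{(k+1)}. (6.1.7)  The proposition is applicable with ℋ₀ the subspace of axial
  gauge configurations defined by the k^{th} axial gauge delta function δ_{k,Ax}(B′) and the delta function δ(QB′). The
  covariance C of the proposition then agrees with C^{(k)} defined in (4.3.3), and this is also the covariance in (6.1.7).
  Furthermore, the translation B′ = B − L^{−d/2}C^{(k)}H_k^*∂^*Q^{e*}_{k+1}f^{(k+1)} (6.1.8) and the decomposition (A16)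
  yield ⟨f^{(k)},σ_kf^{(k)}⟩ = ⟨B,Δ_kB⟩ + L^{−d}⟨Q^{e*}_{k+1}f^{(k+1)}, (I − ∂G_{k,Ax}∂^* − ∂H_kC^{(k)}H_k^*∂^*)
  Q^{e*}_{k+1}f^{(k+1)}⟩. (6.1.9)  Using (6.1.4) and the representation (5.1.15), we can rewrite (6.1.9) as
  ⟨f^{(k)},σ_kf^{(k)}⟩ = ⟨B,Δ_kB⟩ + 𝒮_L^{−1}⟨f^{(k+1)},σ_{k+1}f^{(k+1)}⟩, where the scaling 𝒮_L absorbs the factor L^{−d}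
  and where σ_{k+1} = Q^e_{k+1}(I − ∂G_{k+1,Ax}∂^*)Q^{e*}_{k+1}. This verifies the inductive hypothesis."*
* Inputs quoted: (4.2.2) p. 310 *"σ_k = Q^e_k(I − ∂G_{k,Ax}∂^*)Q^{e*}_k"*; (4.3.1) p. 311 *"⟨∂B, σ_k∂B⟩ = ⟨B, Δ_kB⟩, which
  defines an action Δ_k"*; (5.3.1) p. 317 *"H_{k,Ax}B = Q^{s*}_kB − G_{k,Ax}∂^*Q^{e*}_k∂B"*; (5.2.1) p. 316 (printed as
  "Proposition 6.2") *"G_{k,Ax} = H_{k−1,Ax}C^{(k−1)}H^*_{k−1,Ax} + G_{k−1,Ax}"*; (5.2.8) p. 316 *"H^*_{j,Ax}∂^* = H^*_j∂^*"*;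
  the adjoints `^*` are taken in the inner products (2.14)/(2.20) p. 304–305 (*"using the inner product (2.14)"*);
  Proposition A3 (A15)–(A16) p. 328 = `BIJ85AppAStatements.ConstrainedForm.EqA15A16`.

THE TYPING (pure operator algebra, as for `BIJ85Sect4Statements.eq422` / `prop521_iff`).  Five real inner product spaces:
`Bd` = unit-lattice bond fields B, B′ (the space ℋ of Proposition A3), `P₁` = unit-lattice plaquette fields f^{(k)},
`PL` = L-lattice plaquette fields f^{(k+1)}, `A` = η-lattice bond fields, `Pη` = η-lattice plaquette fields; the printed
operators as real-linear maps between them (`d₁` = ∂ on unit-lattice bond fields, `dη` = ∂ on the η-lattice with adjoint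
`dηs` = ∂^*, `G` = G_{k,Ax}, `G'` = G_{k+1,Ax}, `Qek`/`Qeks` = Q^e_k/Q^{e*}_k, `Qe`/`Qes` = Q^e/Q^{e*} (one step, unit → L-lattice),
`Qek1`/`Qek1s` = Q^e_{k+1}/Q^{e*}_{k+1}, `Hk`/`Hks` = H_k/H_k^*, `Hax`/`Haxs` = H_{k,Ax}/H^*_{k,Ax}, `Qss` = Q^{s*}_k, `Ck` = C^{(k)},
`Δk` = Δ_k, `σk` = σ_k, `σk1` = σ_{k+1}); every `…s` map is tied to its partner by the adjoint identity in the inner products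
(hypotheses `hd`, `hQek`, `hQe`, `hQek1`, `hHk`, `hHax`).  EVERY printed input is an explicit hypothesis named after its
display (`h422`, `h431`, `h531`, `h614`, `hdQ`, `h521`, `h422'` = the last display of p. 319 defining σ_{k+1}, `hQ` =
"Q^eQ^e_k = Q^e_{k+1}", `hG` = symmetry of the covariance G_{k,Ax} of (4.1.1), `hA16` = Proposition A3 (A15)–(A16) for the
constrained form {ℋ = `Bd`, ⟨·,·⟩, ℋ₀ = `H0` ∋ B′, Δ = Δ_k, C = C^{(k)}} built with the tree's carrier `ConstrainedForm`,
`h64` = (6.4), `h618` = (6.1.8)); the factor L^{−d/2} is a real `l` and 𝒮_L^{−1}⟨·,·⟩ = L^{−d}⟨·,·⟩ = l²⟨·,·⟩ (p. 319 "the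
scaling 𝒮_L absorbs the factor L^{−d}"; `eq611_L` spells l = L^{−d/2}).  WHAT IS PROVED: `eq615` ((6.1.5) from (5.3.1),
(6.1.4), ∂Q^{s*}_k = Q^{e*}_k∂), `eq528_of_eq614` ((5.2.8) at j = k is the adjoint of (6.1.4)), `inner_sigma` (the value of
⟨f, σ_kg⟩ from (4.2.2)), `eq616` ((6.1.2)–(6.1.6): the form in B′), `eq617` ((6.1.7) is the minimum, from (A15)),
`eq619` ((6.1.8) + (A16) ⇒ (6.1.9)), **`eq611`** ((6.1.1)) and `eq611_L` (the same with L^{−d} written out).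
TRANSCRIPT NOTE T1 (p. 319, located, harmless): the text cites "the representation (5.1.15)"; Sect. 5.1's last display is
(5.1.14) — the representation used to pass from (6.1.9) to (6.1.1) is (5.2.1) (Prop. 5.2.1, printed "Proposition 6.2")
together with (5.2.8), exactly as in the proof of Prop. 5.2.2 p. 316; this is what `eq611` uses (hypotheses `h521`, and
(5.2.8) DERIVED from `h614`).  Carrier clauses (F6): the functional-integral definitions (4.1.1), (4.1.3), (4.2.1), (4.3.3)
of G_{k,Ax}, H_{k,Ax}, σ_k, C^{(k)}, the lattice geometry behind Q^e, Q^s, ∂ and the membership predicate of ℋ₀ (axial gauge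
∩ {QB′ = 0}) are the instance's; NOTHING of the paper is asserted beyond the kernel-checked algebra below.
-/

open scoped RealInnerProductSpace

namespace Literature.MathematicalPhysics.QuantumFieldTheory.BalabanImbrieJaffe1984to88.BIJ85Eq611Proof

open BIJ85AppAStatements

variable {Bd : Type} [NormedAddCommGroup Bd] [InnerProductSpace ℝ Bd]
variable {P₁ : Type*} [NormedAddCommGroup P₁] [InnerProductSpace ℝ P₁]
variable {PL : Type*} [NormedAddCommGroup PL] [InnerProductSpace ℝ PL]
variable {A : Type*} [NormedAddCommGroup A] [InnerProductSpace ℝ A]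
variable {Pη : Type*} [NormedAddCommGroup Pη] [InnerProductSpace ℝ Pη]

/-- Adjoint bookkeeping in a real inner product (the paper's `^*`, *"using the inner product (2.14)"* p. 304): if
⟨Tx, y⟩ = ⟨x, T^*y⟩ for all x, y then also ⟨T^*y, x⟩ = ⟨y, Tx⟩. [folklore] -/
private theorem adj_flip {E F : Type*} [NormedAddCommGroup E] [InnerProductSpace ℝ E] [NormedAddCommGroup F]
    [InnerProductSpace ℝ F] (T : E →ₗ[ℝ] F) (Ts : F →ₗ[ℝ] E) (h : ∀ x y, ⟪T x, y⟫ = ⟪x, Ts y⟫) (y : F) (x : E) :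
    ⟪Ts y, x⟫ = ⟪y, T x⟫ := by
  rw [real_inner_comm x (Ts y), ← h, real_inner_comm]

/-! ## (6.1.5) and (5.2.8): consequences of (5.3.1) and the gauge invariance statement (6.1.4) -/

/-- **(6.1.5)** p. 319 [PDF 21], verbatim: *"By (5.3.1), H_{k,Ax} = Q^{s*}_k − G_{k,Ax}∂^*Q^{e*}_k∂. Apply ∂ to this identity,
and use the gauge invariance statement ∂H_{k,Ax} = ∂H_k (6.1.4) and the identity ∂Q^{s*}_k = Q^{e*}_k∂. It follows that
∂H_k = (I − ∂G_{k,Ax}∂^*)Q^{e*}_k∂. (6.1.5)"* — PROVED as operator algebra from exactly these three inputs (`h531` = (5.3.1),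
`h614` = (6.1.4), `hdQ` = ∂Q^{s*}_k = Q^{e*}_k∂). [cite: BalabanImbrieJaffe1985, (6.1.5) p.319] -/
theorem eq615 (d₁ : Bd →ₗ[ℝ] P₁) (dη : A →ₗ[ℝ] Pη) (dηs : Pη →ₗ[ℝ] A) (G : A →ₗ[ℝ] A) (Qeks : P₁ →ₗ[ℝ] Pη)
    (Qss Hax Hk : Bd →ₗ[ℝ] A) (h531 : Hax = Qss - G ∘ₗ dηs ∘ₗ Qeks ∘ₗ d₁) (h614 : dη ∘ₗ Hax = dη ∘ₗ Hk)
    (hdQ : dη ∘ₗ Qss = Qeks ∘ₗ d₁) :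
    dη ∘ₗ Hk = (LinearMap.id - dη ∘ₗ G ∘ₗ dηs) ∘ₗ Qeks ∘ₗ d₁ := by
  ext b
  have h1 : dη (Qss b) = Qeks (d₁ b) := by simpa using LinearMap.congr_fun hdQ b
  have h2 : dη (Hk b) = dη (Hax b) := by simpa using (LinearMap.congr_fun h614 b).symm
  simp only [LinearMap.comp_apply, LinearMap.sub_apply, LinearMap.id_apply, h2, h531, map_sub, h1]

/-- **(5.2.8)** p. 316 [PDF 18], verbatim: *"the fact that H^*_{j,Ax}∂^* = H^*_j∂^*, (5.2.8)"* — at j = k this is the ADJOINT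
of the gauge invariance statement (6.1.4) ∂H_{k,Ax} = ∂H_k, and is so DERIVED here (adjoints in the inner products
(2.14)/(2.20)). [cite: BalabanImbrieJaffe1985, (5.2.8) p.316] -/
theorem eq528_of_eq614 (dη : A →ₗ[ℝ] Pη) (dηs : Pη →ₗ[ℝ] A) (hd : ∀ a p, ⟪dη a, p⟫ = ⟪a, dηs p⟫)
    (Hk Hax : Bd →ₗ[ℝ] A) (Hks Haxs : A →ₗ[ℝ] Bd) (hHk : ∀ b a, ⟪Hk b, a⟫ = ⟪b, Hks a⟫)
    (hHax : ∀ b a, ⟪Hax b, a⟫ = ⟪b, Haxs a⟫) (h614 : dη ∘ₗ Hax = dη ∘ₗ Hk) :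
    Haxs ∘ₗ dηs = Hks ∘ₗ dηs := by
  ext p
  apply ext_inner_left ℝ
  intro b
  have h := LinearMap.congr_fun h614 b
  simp only [LinearMap.comp_apply] at h
  simp only [LinearMap.comp_apply]
  rw [← hHax, ← hd, ← hHk, ← hd, h]

/-! ## (4.2.2): the value of the form ⟨f, σ_k g⟩ and its symmetry -/

/-- **(4.2.2)** p. 310 [PDF 12] evaluated in the inner products: with σ_k = Q^e_k(I − ∂G_{k,Ax}∂^*)Q^{e*}_k one has
⟨f, σ_kg⟩ = ⟨Q^{e*}_kf, Q^{e*}_kg⟩ − ⟨∂^*Q^{e*}_kf, G_{k,Ax}∂^*Q^{e*}_kg⟩ (the form (4.2.1) expressed through the adjoints;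
cf. the remark after (4.2.7) p. 311). [cite: BalabanImbrieJaffe1985, (4.2.2) p.310] -/
theorem inner_sigma {X : Type*} [NormedAddCommGroup X] [InnerProductSpace ℝ X] (dη : A →ₗ[ℝ] Pη) (dηs : Pη →ₗ[ℝ] A)
    (hd : ∀ a p, ⟪dη a, p⟫ = ⟪a, dηs p⟫) (G : A →ₗ[ℝ] A) (Q : Pη →ₗ[ℝ] X) (Qs : X →ₗ[ℝ] Pη)
    (hQ : ∀ p f, ⟪Q p, f⟫ = ⟪p, Qs f⟫) (σ : X →ₗ[ℝ] X) (h422 : σ = Q ∘ₗ (LinearMap.id - dη ∘ₗ G ∘ₗ dηs) ∘ₗ Qs)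
    (f g : X) : ⟪f, σ g⟫ = ⟪Qs f, Qs g⟫ - ⟪dηs (Qs f), G (dηs (Qs g))⟫ := by
  rw [h422]
  simp only [LinearMap.comp_apply, LinearMap.sub_apply, LinearMap.id_apply]
  rw [← adj_flip Q Qs hQ, inner_sub_right, ← adj_flip dη dηs hd]

/-- **(4.2.2)**: σ_k = Q^e_k(I − ∂G_{k,Ax}∂^*)Q^{e*}_k is a SYMMETRIC form, ⟨f, σ_kg⟩ = ⟨g, σ_kf⟩, G_{k,Ax} being a covariance
((4.1.1) p. 309: symmetric) — the fact used in writing the cross term of (6.1.2) as 2L^{−d/2}⟨∂B′, σ_kQ^{e*}f^{(k+1)}⟩.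
[cite: BalabanImbrieJaffe1985, (4.2.2) p.310] -/
theorem inner_sigma_comm {X : Type*} [NormedAddCommGroup X] [InnerProductSpace ℝ X] (dη : A →ₗ[ℝ] Pη)
    (dηs : Pη →ₗ[ℝ] A) (hd : ∀ a p, ⟪dη a, p⟫ = ⟪a, dηs p⟫) (G : A →ₗ[ℝ] A) (hG : ∀ a a', ⟪G a, a'⟫ = ⟪a, G a'⟫)
    (Q : Pη →ₗ[ℝ] X) (Qs : X →ₗ[ℝ] Pη) (hQ : ∀ p f, ⟪Q p, f⟫ = ⟪p, Qs f⟫) (σ : X →ₗ[ℝ] X)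
    (h422 : σ = Q ∘ₗ (LinearMap.id - dη ∘ₗ G ∘ₗ dηs) ∘ₗ Qs) (f g : X) : ⟪f, σ g⟫ = ⟪g, σ f⟫ := by
  rw [inner_sigma dη dηs hd G Q Qs hQ σ h422 f g, inner_sigma dη dηs hd G Q Qs hQ σ h422 g f,
    real_inner_comm (Qs f) (Qs g), ← hG (dηs (Qs g)) (dηs (Qs f)), real_inner_comm (dηs (Qs f)) (G (dηs (Qs g)))]

/-! ## (6.1.2)–(6.1.6): the form ⟨f^{(k)}, σ_kf^{(k)}⟩ as a function of B′ -/

/-- **(6.1.2)–(6.1.6)** pp. 318–319 [PDF 20–21]: with f^{(k)} = ∂B′ + L^{−d/2}Q^{e*}f^{(k+1)} ((6.4)), the expansion (6.1.2),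
the rewriting (6.1.3) by (4.3.1), (4.2.2) and Q^eQ^e_k = Q^e_{k+1}, and the substitution of (6.1.5) give (6.1.6), verbatim:
*"⟨f^{(k)},σ_kf^{(k)}⟩ = ⟨B′,Δ_kB′⟩ + 2L^{−d/2}⟨B′,H_k^*∂^*Q^{e*}_{k+1}f^{(k+1)}⟩ + L^{−d}⟨Q^{e*}_{k+1}f^{(k+1)},
(I − ∂G_{k,Ax}∂^*)Q^{e*}_{k+1}f^{(k+1)}⟩. (6.1.6)"* (L^{−d/2} = `l`). [cite: BalabanImbrieJaffe1985, (6.1.2)–(6.1.6) pp.318–319] -/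
theorem eq616 (d₁ : Bd →ₗ[ℝ] P₁) (dη : A →ₗ[ℝ] Pη) (dηs : Pη →ₗ[ℝ] A) (G : A →ₗ[ℝ] A) (Qek : Pη →ₗ[ℝ] P₁)
    (Qeks : P₁ →ₗ[ℝ] Pη) (Qe : P₁ →ₗ[ℝ] PL) (Qes : PL →ₗ[ℝ] P₁) (Qek1 : Pη →ₗ[ℝ] PL) (Qek1s : PL →ₗ[ℝ] Pη)
    (Hk Hax Qss : Bd →ₗ[ℝ] A) (Hks : A →ₗ[ℝ] Bd) (Δk : Bd →ₗ[ℝ] Bd) (σk : P₁ →ₗ[ℝ] P₁)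
    (hd : ∀ a p, ⟪dη a, p⟫ = ⟪a, dηs p⟫) (hQek : ∀ p f, ⟪Qek p, f⟫ = ⟪p, Qeks f⟫)
    (hQe : ∀ f g, ⟪Qe f, g⟫ = ⟪f, Qes g⟫) (hQek1 : ∀ p g, ⟪Qek1 p, g⟫ = ⟪p, Qek1s g⟫)
    (hHk : ∀ b a, ⟪Hk b, a⟫ = ⟪b, Hks a⟫) (hG : ∀ a a', ⟪G a, a'⟫ = ⟪a, G a'⟫)
    (h422 : σk = Qek ∘ₗ (LinearMap.id - dη ∘ₗ G ∘ₗ dηs) ∘ₗ Qeks) (hQ : Qe ∘ₗ Qek = Qek1)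
    (h431 : ∀ b b' : Bd, ⟪d₁ b, σk (d₁ b')⟫ = ⟪b, Δk b'⟫) (h531 : Hax = Qss - G ∘ₗ dηs ∘ₗ Qeks ∘ₗ d₁)
    (h614 : dη ∘ₗ Hax = dη ∘ₗ Hk) (hdQ : dη ∘ₗ Qss = Qeks ∘ₗ d₁)
    (l : ℝ) (f1 : P₁) (fL : PL) (B' : Bd) (h64 : f1 = d₁ B' + l • Qes fL) :
    ⟪f1, σk f1⟫ = ⟪B', Δk B'⟫ + 2 * l * ⟪B', Hks (dηs (Qek1s fL))⟫
      + l ^ 2 * (⟪Qek1s fL, Qek1s fL⟫ - ⟪dηs (Qek1s fL), G (dηs (Qek1s fL))⟫) := by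
  -- Q^{e*}_k Q^{e*} = Q^{e*}_{k+1}: the adjoint of "Q^e Q^e_k = Q^e_{k+1}"
  have hQs : ∀ x : PL, Qeks (Qes x) = Qek1s x := by
    intro x
    apply ext_inner_left ℝ
    intro v
    have hc : Qe (Qek v) = Qek1 v := by rw [← hQ]; rfl
    rw [← hQek, ← hQe, ← hQek1, hc]
  -- (6.1.5) applied to B′: (I − ∂G∂^*)Q^{e*}_k∂B′ = ∂H_kB′
  have h615 : Qeks (d₁ B') - dη (G (dηs (Qeks (d₁ B')))) = dη (Hk B') := by
    have h := LinearMap.congr_fun (eq615 d₁ dη dηs G Qeks Qss Hax Hk h531 h614 hdQ) B'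
    simpa using h.symm
  -- (6.1.2): bilinear expansion, σ_k symmetric
  have hsymm := inner_sigma_comm dη dηs hd G hG Qek Qeks hQek σk h422
  have hval := inner_sigma dη dηs hd G Qek Qeks hQek σk h422
  have h612 : ⟪f1, σk f1⟫ = ⟪d₁ B', σk (d₁ B')⟫ + 2 * l * ⟪d₁ B', σk (Qes fL)⟫
      + l ^ 2 * ⟪Qes fL, σk (Qes fL)⟫ := by
    rw [h64, map_add, map_smul, inner_add_left, inner_add_right, inner_add_right, real_inner_smul_left,
      real_inner_smul_left, real_inner_smul_right, real_inner_smul_right, hsymm (Qes fL) (d₁ B')]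
    ring
  -- (6.1.3) and (6.1.6): the three terms
  have h3 : ⟪d₁ B', σk (Qes fL)⟫ = ⟪B', Hks (dηs (Qek1s fL))⟫ := by
    rw [hsymm (d₁ B') (Qes fL), hval (Qes fL) (d₁ B'), hQs, adj_flip dη dηs hd, ← inner_sub_right, h615,
      ← adj_flip dη dηs hd, real_inner_comm (Hk B'), hHk]
  have h4 : ⟪Qes fL, σk (Qes fL)⟫ = ⟪Qek1s fL, Qek1s fL⟫ - ⟪dηs (Qek1s fL), G (dηs (Qek1s fL))⟫ := by
    rw [hval (Qes fL) (Qes fL), hQs]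
  rw [h612, h431, h3, h4]

/-! ## (6.1.7)–(6.1.9): Proposition A3 applied to the form (6.1.6) -/

/-- **(6.1.7)** p. 319 [PDF 21], verbatim: *"Consider the quadratic form (6.1.6) as a function of B′ and subject to the axial
gauge and averaging restrictions of the integral (6.1). The minimum of the form is given by Proposition A3 of the Appendix,
namely B′ = −L^{−d/2}C^{(k)}H_k^*∂^*Q^{e*}_{k+1}f^{(k+1)}. (6.1.7) The proposition is applicable with ℋ₀ the subspace of
axial gauge configurations defined by the k^{th} axial gauge delta function δ_{k,Ax}(B′) and the delta function δ(QB′). The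
covariance C of the proposition then agrees with C^{(k)} defined in (4.3.3)"* — PROVED from Proposition A3 (A15) (the tree's
`ConstrainedForm.EqA15A16`, clauses 1–2) for the constrained form {ℋ = bond fields, ℋ₀ = `H0`, Δ = Δ_k, C = C^{(k)}} and the
source −L^{−d/2}H_k^*∂^*Q^{e*}_{k+1}f^{(k+1)} (=: −l•J): the configuration (6.1.7) lies in ℋ₀ and minimizes
½⟨B′,Δ_kB′⟩ + l⟨B′,J⟩ (half the B′-dependent part of (6.1.6)) over ℋ₀. [cite: BalabanImbrieJaffe1985, (6.1.7) p.319] -/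
theorem eq617 (Ck Δk V Δ0 GΔ PΔ : Bd →ₗ[ℝ] Bd) (H0 : Bd → Prop)
    (hA16 : ConstrainedForm.EqA15A16
      { H := Bd, ip := fun x y => ⟪x, y⟫, inH0 := H0, Δ := Δk, V := V, Δ₀ := Δ0, G := GΔ, P := PΔ, C := Ck })
    (l : ℝ) (J : Bd) :
    H0 (-(l • Ck J)) ∧ ∀ B' : Bd, H0 B' →
      (1 / 2) * ⟪-(l • Ck J), Δk (-(l • Ck J))⟫ + l * ⟪-(l • Ck J), J⟫ ≤ (1 / 2) * ⟪B', Δk B'⟫ + l * ⟪B', J⟫ := by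
  obtain ⟨h1, h2, -⟩ := hA16 (-(l • J))
  have hC : Ck (-(l • J)) = -(l • Ck J) := by rw [map_neg, map_smul]
  dsimp only at h1 h2
  rw [hC] at h1 h2
  refine ⟨h1, fun B' hB' => ?_⟩
  have h := h2 B' hB'
  rw [inner_neg_right, inner_neg_right, real_inner_smul_right, real_inner_smul_right] at h
  linarith

/-- **(6.1.9)** p. 319 [PDF 21], verbatim: *"Furthermore, the translation B′ = B − L^{−d/2}C^{(k)}H_k^*∂^*Q^{e*}_{k+1}f^{(k+1)}
(6.1.8) and the decomposition (A16) yield ⟨f^{(k)},σ_kf^{(k)}⟩ = ⟨B,Δ_kB⟩ + L^{−d}⟨Q^{e*}_{k+1}f^{(k+1)},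
(I − ∂G_{k,Ax}∂^* − ∂H_kC^{(k)}H_k^*∂^*)Q^{e*}_{k+1}f^{(k+1)}⟩. (6.1.9)"* — PROVED for B′ ∈ ℋ₀ from (6.1.6) (`eq616`'s
hypotheses) and Proposition A3 (A16) (`ConstrainedForm.EqA15A16`, clause 3, for the constrained form {ℋ = bond fields,
ℋ₀ = `H0`, Δ = Δ_k, C = C^{(k)}}); L^{−d/2} = `l`, L^{−d} = l². [cite: BalabanImbrieJaffe1985, (6.1.9) p.319] -/
theorem eq619 (d₁ : Bd →ₗ[ℝ] P₁) (dη : A →ₗ[ℝ] Pη) (dηs : Pη →ₗ[ℝ] A) (G : A →ₗ[ℝ] A) (Qek : Pη →ₗ[ℝ] P₁)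
    (Qeks : P₁ →ₗ[ℝ] Pη) (Qe : P₁ →ₗ[ℝ] PL) (Qes : PL →ₗ[ℝ] P₁) (Qek1 : Pη →ₗ[ℝ] PL) (Qek1s : PL →ₗ[ℝ] Pη)
    (Hk Hax Qss : Bd →ₗ[ℝ] A) (Hks : A →ₗ[ℝ] Bd) (Ck Δk V Δ0 GΔ PΔ : Bd →ₗ[ℝ] Bd) (H0 : Bd → Prop)
    (σk : P₁ →ₗ[ℝ] P₁)
    (hd : ∀ a p, ⟪dη a, p⟫ = ⟪a, dηs p⟫) (hQek : ∀ p f, ⟪Qek p, f⟫ = ⟪p, Qeks f⟫)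
    (hQe : ∀ f g, ⟪Qe f, g⟫ = ⟪f, Qes g⟫) (hQek1 : ∀ p g, ⟪Qek1 p, g⟫ = ⟪p, Qek1s g⟫)
    (hHk : ∀ b a, ⟪Hk b, a⟫ = ⟪b, Hks a⟫) (hG : ∀ a a', ⟪G a, a'⟫ = ⟪a, G a'⟫)
    (h422 : σk = Qek ∘ₗ (LinearMap.id - dη ∘ₗ G ∘ₗ dηs) ∘ₗ Qeks) (hQ : Qe ∘ₗ Qek = Qek1)
    (h431 : ∀ b b' : Bd, ⟪d₁ b, σk (d₁ b')⟫ = ⟪b, Δk b'⟫) (h531 : Hax = Qss - G ∘ₗ dηs ∘ₗ Qeks ∘ₗ d₁)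
    (h614 : dη ∘ₗ Hax = dη ∘ₗ Hk) (hdQ : dη ∘ₗ Qss = Qeks ∘ₗ d₁)
    (hA16 : ConstrainedForm.EqA15A16
      { H := Bd, ip := fun x y => ⟪x, y⟫, inH0 := H0, Δ := Δk, V := V, Δ₀ := Δ0, G := GΔ, P := PΔ, C := Ck })
    (l : ℝ) (f1 : P₁) (fL : PL) (B' B : Bd) (hB' : H0 B') (h64 : f1 = d₁ B' + l • Qes fL)
    (h618 : B = B' + l • Ck (Hks (dηs (Qek1s fL)))) :
    ⟪f1, σk f1⟫ = ⟪B, Δk B⟫ + l ^ 2 * (⟪Qek1s fL, Qek1s fL⟫ - ⟪dηs (Qek1s fL), G (dηs (Qek1s fL))⟫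
      - ⟪Qek1s fL, dη (Hk (Ck (Hks (dηs (Qek1s fL)))))⟫) := by
  rw [eq616 d₁ dη dηs G Qek Qeks Qe Qes Qek1 Qek1s Hk Hax Qss Hks Δk σk hd hQek hQe hQek1 hHk hG h422 hQ h431 h531
    h614 hdQ l f1 fL B' h64]
  -- (A16) with x = B′ ∈ ℋ₀ and the source −l•J, J = H_k^*∂^*Q^{e*}_{k+1}f^{(k+1)}
  have h := (hA16 (-(l • Hks (dηs (Qek1s fL))))).2.2 B' hB'
  dsimp only at h
  have hC : Ck (-(l • Hks (dηs (Qek1s fL)))) = -(l • Ck (Hks (dηs (Qek1s fL)))) := by rw [map_neg, map_smul]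
  rw [hC, sub_neg_eq_add, ← h618, inner_neg_right, inner_neg_left, inner_neg_right, neg_neg, real_inner_smul_right,
    real_inner_smul_left, real_inner_smul_right, adj_flip Hk Hks hHk (dηs (Qek1s fL)),
    adj_flip dη dηs hd (Qek1s fL)] at h
  -- ⟨J, C^{(k)}J⟩ = ⟨Q^{e*}_{k+1}f, ∂H_kC^{(k)}H_k^*∂^*Q^{e*}_{k+1}f⟩ by the adjoints of H_k^*, ∂^*; (6.1.9) = 2 × (A16) + (6.1.6)
  linear_combination 2 * h

/-! ## (6.1.1) -/

/-- **(6.1.1)** p. 318 [PDF 20], verbatim: *"6.1. σ_k = σ_{k+1} + Fluctuation Form.  The goal here is to show that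
⟨f^{(k)}, σ_k f^{(k)}⟩ = 𝒮_L^{−1}⟨f^{(k+1)}, σ_{k+1} f^{(k+1)}⟩ + ⟨B, Δ_kB⟩. (6.1.1)"*, p. 319: *"where the scaling 𝒮_L absorbs
the factor L^{−d} and where σ_{k+1} = Q^e_{k+1}(I − ∂G_{k+1,Ax}∂^*)Q^{e*}_{k+1}. This verifies the inductive hypothesis."* —
PROVED along (6.1.2)–(6.1.9) for the decomposed field f^{(k)} = ∂B′ + L^{−d/2}Q^{e*}f^{(k+1)} ((6.4), `h64`), B′ ∈ ℋ₀, and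
the translated fluctuation field B of (6.1.8) (`h618`), from the printed inputs: adjoints in the inner products
(2.14)/(2.20), G_{k,Ax} symmetric ((4.1.1)), (4.2.2) `h422`, Q^eQ^e_k = Q^e_{k+1} `hQ`, (4.3.1) `h431`, (5.3.1) `h531`,
(6.1.4) `h614`, ∂Q^{s*}_k = Q^{e*}_k∂ `hdQ`, (5.2.1) at k+1 `h521` (the "representation (5.1.15)" of the text — transcript note
T1 in the module docstring), σ_{k+1} by the last display of p. 319 `h422'`, and Proposition A3 (A15)–(A16) `hA16`
(`ConstrainedForm.EqA15A16` with ℋ = bond fields, ℋ₀ ∋ B′, Δ = Δ_k, C = C^{(k)}); the scaling factor is written as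
L^{−d/2} = `l`, 𝒮_L^{−1}⟨·,·⟩ = l²⟨·,·⟩ (see `eq611_L`). [cite: BalabanImbrieJaffe1985, (6.1.1) p.318] -/
theorem eq611 (d₁ : Bd →ₗ[ℝ] P₁) (dη : A →ₗ[ℝ] Pη) (dηs : Pη →ₗ[ℝ] A) (G G' : A →ₗ[ℝ] A) (Qek : Pη →ₗ[ℝ] P₁)
    (Qeks : P₁ →ₗ[ℝ] Pη) (Qe : P₁ →ₗ[ℝ] PL) (Qes : PL →ₗ[ℝ] P₁) (Qek1 : Pη →ₗ[ℝ] PL) (Qek1s : PL →ₗ[ℝ] Pη)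
    (Hk Hax Qss : Bd →ₗ[ℝ] A) (Hks Haxs : A →ₗ[ℝ] Bd) (Ck Δk V Δ0 GΔ PΔ : Bd →ₗ[ℝ] Bd) (H0 : Bd → Prop)
    (σk : P₁ →ₗ[ℝ] P₁) (σk1 : PL →ₗ[ℝ] PL)
    (hd : ∀ a p, ⟪dη a, p⟫ = ⟪a, dηs p⟫) (hQek : ∀ p f, ⟪Qek p, f⟫ = ⟪p, Qeks f⟫)
    (hQe : ∀ f g, ⟪Qe f, g⟫ = ⟪f, Qes g⟫) (hQek1 : ∀ p g, ⟪Qek1 p, g⟫ = ⟪p, Qek1s g⟫)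
    (hHk : ∀ b a, ⟪Hk b, a⟫ = ⟪b, Hks a⟫) (hHax : ∀ b a, ⟪Hax b, a⟫ = ⟪b, Haxs a⟫)
    (hG : ∀ a a', ⟪G a, a'⟫ = ⟪a, G a'⟫)
    (h422 : σk = Qek ∘ₗ (LinearMap.id - dη ∘ₗ G ∘ₗ dηs) ∘ₗ Qeks) (hQ : Qe ∘ₗ Qek = Qek1)
    (h431 : ∀ b b' : Bd, ⟪d₁ b, σk (d₁ b')⟫ = ⟪b, Δk b'⟫) (h531 : Hax = Qss - G ∘ₗ dηs ∘ₗ Qeks ∘ₗ d₁)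
    (h614 : dη ∘ₗ Hax = dη ∘ₗ Hk) (hdQ : dη ∘ₗ Qss = Qeks ∘ₗ d₁) (h521 : G' = Hax ∘ₗ Ck ∘ₗ Haxs + G)
    (h422' : σk1 = Qek1 ∘ₗ (LinearMap.id - dη ∘ₗ G' ∘ₗ dηs) ∘ₗ Qek1s)
    (hA16 : ConstrainedForm.EqA15A16
      { H := Bd, ip := fun x y => ⟪x, y⟫, inH0 := H0, Δ := Δk, V := V, Δ₀ := Δ0, G := GΔ, P := PΔ, C := Ck })
    (l : ℝ) (f1 : P₁) (fL : PL) (B' B : Bd) (hB' : H0 B') (h64 : f1 = d₁ B' + l • Qes fL)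
    (h618 : B = B' + l • Ck (Hks (dηs (Qek1s fL)))) :
    ⟪f1, σk f1⟫ = l ^ 2 * ⟪fL, σk1 fL⟫ + ⟪B, Δk B⟫ := by
  rw [eq619 d₁ dη dηs G Qek Qeks Qe Qes Qek1 Qek1s Hk Hax Qss Hks Ck Δk V Δ0 GΔ PΔ H0 σk hd hQek hQe hQek1 hHk hG h422
    hQ h431 h531 h614 hdQ hA16 l f1 fL B' B hB' h64 h618]
  -- (6.1.4) and (5.2.8): ∂H_kC^{(k)}H_k^*∂^* = ∂H_{k,Ax}C^{(k)}H^*_{k,Ax}∂^*; with (5.2.1) the η-lattice operator of (6.1.9)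
  -- is I − ∂G_{k+1,Ax}∂^*, and by the adjoint Q^{e*}_{k+1} its form at Q^{e*}_{k+1}f^{(k+1)} is ⟨f^{(k+1)}, σ_{k+1}f^{(k+1)}⟩
  have h528 := eq528_of_eq614 dη dηs hd Hk Hax Hks Haxs hHk hHax h614
  have hHs : Hks (dηs (Qek1s fL)) = Haxs (dηs (Qek1s fL)) := by
    simpa using (LinearMap.congr_fun h528 (Qek1s fL)).symm
  have hH : dη (Hk (Ck (Haxs (dηs (Qek1s fL))))) = dη (Hax (Ck (Haxs (dηs (Qek1s fL))))) := by
    simpa using (LinearMap.congr_fun h614 (Ck (Haxs (dηs (Qek1s fL))))).symm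
  rw [inner_sigma dη dηs hd G' Qek1 Qek1s hQek1 σk1 h422' fL fL, h521, hHs, hH]
  simp only [LinearMap.add_apply, LinearMap.comp_apply, inner_add_right]
  rw [adj_flip dη dηs hd (Qek1s fL) (Hax (Ck (Haxs (dηs (Qek1s fL)))))]
  ring

/-- **(6.1.1)** with the scaling written out: for L > 0 and L^{−d/2} = (√L)^{−d}, 𝒮_L^{−1}⟨f^{(k+1)},σ_{k+1}f^{(k+1)}⟩ =
L^{−d}⟨f^{(k+1)},σ_{k+1}f^{(k+1)}⟩ (p. 319: *"where the scaling 𝒮_L absorbs the factor L^{−d}"*), i.e.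
⟨f^{(k)},σ_kf^{(k)}⟩ = L^{−d}⟨f^{(k+1)},σ_{k+1}f^{(k+1)}⟩ + ⟨B,Δ_kB⟩. [cite: BalabanImbrieJaffe1985, (6.1.1) p.318] -/
theorem eq611_L (d₁ : Bd →ₗ[ℝ] P₁) (dη : A →ₗ[ℝ] Pη) (dηs : Pη →ₗ[ℝ] A) (G G' : A →ₗ[ℝ] A) (Qek : Pη →ₗ[ℝ] P₁)
    (Qeks : P₁ →ₗ[ℝ] Pη) (Qe : P₁ →ₗ[ℝ] PL) (Qes : PL →ₗ[ℝ] P₁) (Qek1 : Pη →ₗ[ℝ] PL) (Qek1s : PL →ₗ[ℝ] Pη)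
    (Hk Hax Qss : Bd →ₗ[ℝ] A) (Hks Haxs : A →ₗ[ℝ] Bd) (Ck Δk V Δ0 GΔ PΔ : Bd →ₗ[ℝ] Bd) (H0 : Bd → Prop)
    (σk : P₁ →ₗ[ℝ] P₁) (σk1 : PL →ₗ[ℝ] PL)
    (hd : ∀ a p, ⟪dη a, p⟫ = ⟪a, dηs p⟫) (hQek : ∀ p f, ⟪Qek p, f⟫ = ⟪p, Qeks f⟫)
    (hQe : ∀ f g, ⟪Qe f, g⟫ = ⟪f, Qes g⟫) (hQek1 : ∀ p g, ⟪Qek1 p, g⟫ = ⟪p, Qek1s g⟫)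
    (hHk : ∀ b a, ⟪Hk b, a⟫ = ⟪b, Hks a⟫) (hHax : ∀ b a, ⟪Hax b, a⟫ = ⟪b, Haxs a⟫)
    (hG : ∀ a a', ⟪G a, a'⟫ = ⟪a, G a'⟫)
    (h422 : σk = Qek ∘ₗ (LinearMap.id - dη ∘ₗ G ∘ₗ dηs) ∘ₗ Qeks) (hQ : Qe ∘ₗ Qek = Qek1)
    (h431 : ∀ b b' : Bd, ⟪d₁ b, σk (d₁ b')⟫ = ⟪b, Δk b'⟫) (h531 : Hax = Qss - G ∘ₗ dηs ∘ₗ Qeks ∘ₗ d₁)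
    (h614 : dη ∘ₗ Hax = dη ∘ₗ Hk) (hdQ : dη ∘ₗ Qss = Qeks ∘ₗ d₁) (h521 : G' = Hax ∘ₗ Ck ∘ₗ Haxs + G)
    (h422' : σk1 = Qek1 ∘ₗ (LinearMap.id - dη ∘ₗ G' ∘ₗ dηs) ∘ₗ Qek1s)
    (hA16 : ConstrainedForm.EqA15A16
      { H := Bd, ip := fun x y => ⟪x, y⟫, inH0 := H0, Δ := Δk, V := V, Δ₀ := Δ0, G := GΔ, P := PΔ, C := Ck })
    (L : ℝ) (hL : 0 < L) (d : ℕ) (f1 : P₁) (fL : PL) (B' B : Bd) (hB' : H0 B')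
    (h64 : f1 = d₁ B' + ((Real.sqrt L)⁻¹ ^ d) • Qes fL)
    (h618 : B = B' + ((Real.sqrt L)⁻¹ ^ d) • Ck (Hks (dηs (Qek1s fL)))) :
    ⟪f1, σk f1⟫ = (L ^ d)⁻¹ * ⟪fL, σk1 fL⟫ + ⟪B, Δk B⟫ := by
  have h := eq611 d₁ dη dηs G G' Qek Qeks Qe Qes Qek1 Qek1s Hk Hax Qss Hks Haxs Ck Δk V Δ0 GΔ PΔ H0 σk σk1 hd hQek hQe
    hQek1 hHk hHax hG h422 hQ h431 h531 h614 hdQ h521 h422' hA16 ((Real.sqrt L)⁻¹ ^ d) f1 fL B' B hB' h64 h618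
  have hl : ((Real.sqrt L)⁻¹ ^ d) ^ 2 = (L ^ d)⁻¹ := by
    rw [← pow_mul, mul_comm, pow_mul, inv_pow, Real.sq_sqrt hL.le, inv_pow]
  rw [h, hl]

end Literature.MathematicalPhysics.QuantumFieldTheory.BalabanImbrieJaffe1984to88.BIJ85Eq611Proof
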